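import Summits.NavierStokesRegularity.FluidComputer.PalasekTowerStrainDoorAtPrice
import Summits.NavierStokesRegularity.NavierStokesRegularity.Theorems.EpisodeBaseT.Negative.CertificateSharpAtTunedPrice

/-!
# THE RAW STRAIN CERTIFICATE (skeleton v3 stub `stub_raw_certificateT`) AT `tuned`: JUNK EXCLUSION AND PRICE BY NAME —
# sup datum defect `D ≤ 1/4`, window `h ≤ 2⁻⁸⁴`, `L²` budget `(E₀ + G₂·w₀)·e^{∫Γ} ≤ 2⁻⁶⁵`, and the reference run more
# than DOUBLES its sup speed inside `170` strain times

Cell `ns-blowup`, seat `ns-blowup-refuter4` (g10, K212; ledger refuter of record for route `PalasekTowerBreakdown` rev 19,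
crux stmt-NavierStokesRegularity-20303 `EpisodeBaseT := EpisodeBaseGAt TowerRates.tuned`; LEAD line `straindoor` v3, registered
stub `stub_raw_certificateT : StrainDoor.RawCertificateAt TowerRates.tuned`, `PalasekTowerStrainDoorAtRaw.lean` p531699, price
`PalasekTowerStrainDoorAtPrice.lean` p532337). Negative-lane SUPPORT (`--supports 20303`), no Theses import; theorems only.

The LEAD's price file proves, for any `c : RawCertificateData R U ρ w ψ r Γ Bw G₂ D E₀ h δ η`, `0 ≤ δ`, `Y₁(R) < B_w`,
`h ≤ (24·9.03·(2B_w+1))⁻²`, the budget `(E₀ + G₂w₀)e^{∫Γ} ≤ (δ/2)h^{3/4}` and at `tuned` `10¹⁹·(E₀ + G₂w₀)e^{∫Γ} ≤ 1/4`.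
This file adds the JUNK-EXCLUSION READING of the v3 letter that the refuter's K204/K208 rows state informally, now by kernel
on the letter of record (the same three fields `datum_sup` / `δ_layer` / `δ_le` and the speed readout do the work):

* `datumSup_le_quarter` (`R`-generic): `D ≤ 1/4` — the reference starts `1/4`-sup-close to the sub-`Y₀` datum, so
  `‖w 0 y‖ < Y₀(R) + 1/4` everywhere (`reference_initial_speed_lt`): a STEADY strong reference (speed `≥ Y₁ > Y₀ + 1/4` at
  time `0`) and a LATE-BUMP reference are not certificates;
* `tuned_price`: `h ≤ 2⁻⁸⁴ ∧ (E₀ + G₂·w₀)·e^{∫Γ} ≤ 2⁻⁶⁵` (the refuter's form of the LEAD's `10¹⁹ · budget ≤ 1/4`; both from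
  `2³⁴ ≤ Y₁(tuned) < B_w`);
* `tuned_doubling`: at `tuned` the reference goes from `sup ‖w 0‖ < Y₀ + 1/4` to `‖w(w₀) x‖ > 2Y₀` at some `‖x‖ ≤ ρ` within the
  window `w₀ = wfirstAt tuned`, `w₀·A₀ ≤ 170`, `Y₀·w₀ ≤ 1/4` — i.e. any certificate reference is a genuine near-exact
  (`residual ≤ 2⁻⁶⁵e^{-∫Γ}/w₀` in `L²`) Navier–Stokes run that AMPLIFIES sup speed by `> 2` in `≤ 170` strain times: the
  mechanism itself, not a bookkeeping artefact. Junk inhabitants are excluded; a genuine inhabitant is a design + certified run.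

WHAT THIS IS NOT: not NS — inequalities between the fields of a posited certificate; no design, run, certificate or flow is
exhibited or excluded beyond the junk classes named; `RawCertificateAt tuned` and 20303 stay OPEN.
-/

noncomputable section

namespace Summit.NavierStokesRegularity.EpisodeBaseTRawCertificatePrice

open Set MeasureTheory Metric Real
open Summit.NavierStokesRegularity.FluidComputer
open Summit.NavierStokesRegularity.FluidComputer.PalasekTowerClayBridge
open Summit.NavierStokesRegularity.FluidComputer.PalasekTowerClayBridge.StrainDoor
open Summit.NavierStokesRegularity.EpisodeBaseTStrainDoorPrice

section Generic

variable {R : TowerRates} {U : EuclideanSpace ℝ (Fin 3) → EuclideanSpace ℝ (Fin 3)} {ρ : ℝ}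
  {w : ℝ → EuclideanSpace ℝ (Fin 3) → EuclideanSpace ℝ (Fin 3)} {ψ : ℝ → EuclideanSpace ℝ (Fin 3) → ℝ}
  {r : ℝ → EuclideanSpace ℝ (Fin 3) → EuclideanSpace ℝ (Fin 3)} {Γ : ℝ → ℝ} {Bw G₂ D E₀ h δ η : ℝ}

/-- The sup datum defect of a raw certificate is nonnegative. [folklore] -/
theorem datumSup_nonneg (c : RawCertificateData R U ρ w ψ r Γ Bw G₂ D E₀ h δ η) : 0 ≤ D :=
  (norm_nonneg _).trans (c.datum_sup 0)

/-- The initial-layer term of a raw certificate is at least `2D`. [folklore] -/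
theorem two_datumSup_le_layer (c : RawCertificateData R U ρ w ψ r Γ Bw G₂ D E₀ h δ η) :
    2 * D ≤ 2 * (D + 4 * h ^ (1 / 4 : ℝ) * G₂) * Real.exp (36 * (9.03 : ℝ) ^ 2 * (Bw + 1 + Bw) ^ 2 * h) := by
  have hD := datumSup_nonneg c
  have hh := c.h_pos
  have hG := c.G₂_nonneg
  have ha : 0 ≤ 4 * h ^ (1 / 4 : ℝ) * G₂ := by positivity
  have he : 1 ≤ Real.exp (36 * (9.03 : ℝ) ^ 2 * (Bw + 1 + Bw) ^ 2 * h) :=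
    Real.one_le_exp (by positivity)
  have hsum : 0 ≤ 2 * (D + 4 * h ^ (1 / 4 : ℝ) * G₂) := by positivity
  calc 2 * D ≤ 2 * (D + 4 * h ^ (1 / 4 : ℝ) * G₂) := by linarith
    _ = 2 * (D + 4 * h ^ (1 / 4 : ℝ) * G₂) * 1 := (mul_one _).symm
    _ ≤ 2 * (D + 4 * h ^ (1 / 4 : ℝ) * G₂) * Real.exp (36 * (9.03 : ℝ) ^ 2 * (Bw + 1 + Bw) ^ 2 * h) :=
      mul_le_mul_of_nonneg_left he hsum

/-- **The sup datum defect of a raw certificate is at most `1/4`** (`2D ≤ layer ≤ δ ≤ 1/2`). [folklore] -/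
theorem datumSup_le_quarter (c : RawCertificateData R U ρ w ψ r Γ Bw G₂ D E₀ h δ η) : D ≤ 1 / 4 := by
  have h1 := (two_datumSup_le_layer c).trans c.δ_layer
  have h2 := c.δ_le
  linarith

/-- **The reference of a raw certificate starts sup-close to a sub-`Y₀` datum**: `‖w 0 y‖ < Y₀(R) + 1/4` everywhere —
so a reference whose initial slice already has speed `≥ Y₀(R) + 1/4` somewhere (e.g. a STEADY reference meeting the speed
readout `‖w(w₀) x‖ ≥ Y₁ + η + δ > Y₀ + 1/4` when `2Y₀ ≤ Y₁`, `Y₀ ≥ 1/4`) is not a certificate. [folklore] -/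
theorem reference_initial_speed_lt (c : RawCertificateData R U ρ w ψ r Γ Bw G₂ D E₀ h δ η)
    (y : EuclideanSpace ℝ (Fin 3)) : ‖w 0 y‖ < R.Y 0 + 1 / 4 := by
  have h1 := c.datum_sup y
  have h2 := c.datum_lt y
  have h3 := datumSup_le_quarter c
  calc ‖w 0 y‖ = ‖U y + (w 0 y - U y)‖ := by congr 1; abel
    _ ≤ ‖U y‖ + ‖w 0 y - U y‖ := norm_add_le _ _
    _ < R.Y 0 + 1 / 4 := by linarith

/-- **No time-independent reference**: if the reference slice at time `w₀` equals the slice at time `0`, the letter is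
unsatisfiable as soon as `Y₀(R) + 1/4 ≤ Y₁(R)` (speed readout `> Y₁` at `w₀` versus `< Y₀ + 1/4` at `0`). [folklore] -/
theorem false_of_steady (c : RawCertificateData R U ρ w ψ r Γ Bw G₂ D E₀ h δ η)
    (hsteady : w (Host.wfirstAt R) = w 0) (hY : R.Y 0 + 1 / 4 ≤ R.Y 1) : False := by
  obtain ⟨x, -, hx⟩ := c.speed
  have h0 := reference_initial_speed_lt c x
  have hδ := c.delta_nonneg
  have hη := c.η_pos
  rw [hsteady] at hx
  linarith

end Generic

variable {U : EuclideanSpace ℝ (Fin 3) → EuclideanSpace ℝ (Fin 3)} {ρ : ℝ}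
  {w : ℝ → EuclideanSpace ℝ (Fin 3) → EuclideanSpace ℝ (Fin 3)} {ψ : ℝ → EuclideanSpace ℝ (Fin 3) → ℝ}
  {r : ℝ → EuclideanSpace ℝ (Fin 3) → EuclideanSpace ℝ (Fin 3)} {Γ : ℝ → ℝ} {Bw G₂ D E₀ h δ η : ℝ}

/-- **THE PRICE OF ONE RAW STRAIN CERTIFICATE AT `tuned`** (refuter's form): window `h ≤ 2⁻⁸⁴` and total `L²` defect
`(E₀ + G₂·wfirstAt tuned)·exp(∫₀^{wfirstAt tuned} Γ) ≤ 2⁻⁶⁵ < 2.8·10⁻²⁰` (compare the LEAD's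
`RawCertificateData.defect_budget_tuned`: `10¹⁹ · budget ≤ 1/4`). [cite: DashtiRobinson2008, Thm. 5]
[cite: Palasek2026ElementaryModel, §4] -/
theorem tuned_price (c : RawCertificateData TowerRates.tuned U ρ w ψ r Γ Bw G₂ D E₀ h δ η) :
    h ≤ 1 / 2 ^ 84 ∧
    (E₀ + G₂ * Host.wfirstAt TowerRates.tuned) *
        Real.exp (∫ s in (0 : ℝ)..Host.wfirstAt TowerRates.tuned, Γ s) ≤ 1 / 2 ^ 65 :=
  budget_le_at_tuned c.Y_one_lt_Bw.le c.G₂_nonneg c.h_pos c.h_short c.δ_le c.δ_window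

/-- **NO STEADY RAW CERTIFICATE AT `tuned`** (`Y₀ + 1/4 ≤ 2Y₀ ≤ Y₁` there). [folklore] -/
theorem tuned_not_steady (c : RawCertificateData TowerRates.tuned U ρ w ψ r Γ Bw G₂ D E₀ h δ η)
    (hsteady : w (Host.wfirstAt TowerRates.tuned) = w 0) : False := by
  refine false_of_steady c hsteady ?_
  have hsep := TowerRates.tuned_sep 0
  have hY1 := tuned_Y_one_ge
  simp only [zero_add] at hsep
  linarith

/-- **SPEED DOUBLING INSIDE 170 STRAIN TIMES.** The reference run of any raw strain certificate at `tuned` starts with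
`‖w 0 y‖ < Y₀ + 1/4` everywhere and ends, at `w₀ = wfirstAt tuned`, with `‖w(w₀) x‖ > 2Y₀` at some `‖x‖ ≤ ρ`
(`Y₁ + η + δ ≤ ‖w(w₀) x‖`, `2Y₀ ≤ Y₁` at `tuned`); the window has `w₀·A₀ ≤ 170` and `Y₀·w₀ ≤ 1/4`; and it does so as a
classical solution forced by a raw residual of `L²` size `G₂` with `G₂·w₀·e^{∫Γ} ≤ 2⁻⁶⁵`.
[cite: Palasek2026ElementaryModel, §4] -/
theorem tuned_doubling (c : RawCertificateData TowerRates.tuned U ρ w ψ r Γ Bw G₂ D E₀ h δ η) :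
    (∀ y, ‖w 0 y‖ < TowerRates.tuned.Y 0 + 1 / 4) ∧
    (∃ x, ‖x‖ ≤ ρ ∧ 2 * TowerRates.tuned.Y 0 < ‖w (Host.wfirstAt TowerRates.tuned) x‖) ∧
    Host.wfirstAt TowerRates.tuned * TowerRates.tuned.A 0 ≤ 170 ∧
    TowerRates.tuned.Y 0 * Host.wfirstAt TowerRates.tuned ≤ 1 / 4 ∧
    G₂ * Host.wfirstAt TowerRates.tuned *
        Real.exp (∫ s in (0 : ℝ)..Host.wfirstAt TowerRates.tuned, Γ s) ≤ 1 / 2 ^ 65 := by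
  refine ⟨reference_initial_speed_lt c, ?_, tuned_wfirst_mul_A_zero_le, TowerRates.tuned_Y_mul_window_le 0, ?_⟩
  · obtain ⟨x, hx, hsp⟩ := c.speed
    refine ⟨x, hx, ?_⟩
    have hsep := TowerRates.tuned_sep 0
    have hη := c.η_pos
    have hδ := c.delta_nonneg
    simp only [zero_add] at hsep
    linarith
  · have hp := (tuned_price c).2
    have hE := c.E₀_nonneg
    have hexp : 0 ≤ Real.exp (∫ s in (0 : ℝ)..Host.wfirstAt TowerRates.tuned, Γ s) := (Real.exp_pos _).le
    have h1 : G₂ * Host.wfirstAt TowerRates.tuned ≤ E₀ + G₂ * Host.wfirstAt TowerRates.tuned := by linarith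
    exact (mul_le_mul_of_nonneg_right h1 hexp).trans hp

end Summit.NavierStokesRegularity.EpisodeBaseTRawCertificatePrice

end
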